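import Literature.NumberTheory.GaloisRepresentations.IdeleClassBarTateDualityHypotheses
import Literature.NumberTheory.GaloisRepresentations.GalLayerSystemSESLayers
import HarnessLib

/-!
# The two spellings of the invariant map of the idèle class formation agree: `classBarInvD F = classBarInv F`;
# hence `TateDualityHypotheses (classBarD F) (classBarInv F)` and Tate duality for `inv_F = classBarInv F`
# (Tate C–F VII §11.2 (bis); Milne ADT I Thm. 1.8)

Topic `NumberTheory/GaloisRepresentations`; namespace `Literature.NumberTheory.GaloisRepresentations.IdeleClassBar`.
Sequel to door-c4 g16's `IdeleClassBarInvariant.lean` (`classBarInv F`, uniqueness `eq_classBarInv_of_forall_inflG`) /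
`IdeleClassBarInvariantSubgroup.lean` (`classBarInvD F`, `classData` currency), door-c5 g16's `GalLayerSystemSESLayers.lean`
(`classData_layerCohomologyIso : (classData F).layerCohomologyIso = layerCohomologyIso`, `rfl`) and door-c4 g17's
`IdeleClassBarTateDualityHypotheses.lean`.  Theorems only (no definition, no named fact, no instance, no notation, no `sorry`).

THE POINT.  door-c4 g16 built `inv_F` twice — `classBarInv F` on `Ext²_{C_Γ}(ℤ, classBarD F)` (p594651) and `classBarInvD F` on
the definitionally equal `Ext²_{C_Γ}(ℤ, (classData F).toSystem.toD)` (p597615) — because the relative layers needed for the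
hypotheses at open subgroups live in the `classData` currency and the unifier could not afford to identify the LAYER objects.
With door-c5's `rfl`-lemma `classData_layerCohomologyIso` the layer invariants agree (`layerInvD_eq_layerInv`), hence by the
uniqueness of the descent **`classBarInvD_eq_classBarInv : classBarInvD F = classBarInv F`** (raised `maxRecDepth`), and door-c4
g17's record transfers verbatim: **`tateDualityHypotheses_classBarD_classBarInv : TateDualityHypotheses (classBarD F) (classBarInv F)`**
(the form named in door-c6 g16's F8 docstring), `tateDuality_classBarD_classBarInv`, `adjointMap_one_injective_classBarD_classBarInv`.

HONEST FRAMING: bookkeeping; no new arithmetic; no case of BSD or of Poitou–Tate.  Route A (A5) of crux `AnticycControlAdditiveK`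
(item 19295, cell bsd-schneider), seat door-c4 gen 17.

## References
* J. W. S. Cassels, A. Fröhlich (eds.), *Algebraic Number Theory* (1967), Ch. VII (J. Tate) §11.2 (bis). [CasselsFrohlichANT1967]
* J. S. Milne, *Arithmetic Duality Theorems* (2nd ed. 2006), I §1 Theorem 1.8. [MilneADT2006]
-/

noncomputable section

open NumberField CategoryTheory CategoryTheory.Abelian groupCohomology
open Field (absoluteGaloisGroup)
open Literature.Algebra.Homology Literature.Algebra.Homology.DiscreteRep Literature.Algebra.Homology.ExtDuality
open scoped Classical

namespace Literature.NumberTheory.GaloisRepresentations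

namespace IdeleClassBar

variable (F : Type) [Field F] [NumberField F]

/-- **The layer invariants agree: `layerInvD F E = layerInv E`** (both are `inv_{E/F}` after the layer cohomology
isomorphism; `classData_layerCohomologyIso` is `rfl`). [cite: CasselsFrohlichANT1967, Ch. VII §11.2 (bis)] -/
theorem layerInvD_eq_layerInv (E : GalLayer F) (c : groupCohomology (layerRep E) 2) :
    layerInvD F E c = layerInv E c := by
  rw [layerInv_apply, ← classData_layerCohomologyIso]
  have h := layerInvD_iso_inv F E (((classData F).layerCohomologyIso E 2).hom c)
  rw [← ModuleCat.comp_apply, Iso.hom_inv_id, ModuleCat.id_apply] at h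
  exact h

variable [CompactSpace (absoluteGaloisGroup F)] [TotallyDisconnectedSpace (absoluteGaloisGroup F)]

set_option maxRecDepth 20000 in
set_option maxHeartbeats 800000 in
-- identifying the layer object `(classData F).layerRep E` with `layerRep E` inside `inflG` needs the raised recursion depth
/-- **`classBarInvD F = classBarInv F`**: the two spellings of `inv_F : Ext²_{C_Γ}(ℤ, C̄) →+ ℚ/ℤ` coincide (uniqueness of the
descent `eq_classBarInv_of_forall_inflG`; on every layer both are `inv_{E/F}`).
[cite: CasselsFrohlichANT1967, Ch. VII §11.2 (bis)][cite: MilneADT2006, I §1] -/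
theorem classBarInvD_eq_classBarInv : classBarInvD F = classBarInv F := by
  refine eq_classBarInv_of_forall_inflG (classBarInvD F) fun E c => ?_
  have h1 := LayerColimit.desc_inflG (isCompatibleFamily_layerInvD F) E
    (show groupCohomology ((classData F).layerRep E) 2 from c)
  exact h1.trans (layerInvD_eq_layerInv F E c)

/-- **THE HYPOTHESES OF TATE'S DUALITY THEOREM FOR `(classBarD F, classBarInv F)`** — the spelling of door-c6 g16's F8
docstring (`TateDualityHypotheses (classBarD K) (classBarInv K)`). [cite: MilneADT2006, I Theorem 1.8] -/
theorem tateDualityHypotheses_classBarD_classBarInv : TateDualityHypotheses (classBarD F) (classBarInv F) := by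
  rw [← classBarInvD_eq_classBarInv]
  exact tateDualityHypotheses_classBarD_classBarInvD F

/-- **Tate duality for `(Γ_F, C̄, classBarInv F)`**: for every finite discrete `Γ_F`-module `M`, `α²(Γ_F, M)` and `α¹(Γ_F, M)`
are bijective and `Ext³_{C_Γ}(M, C̄) = 0`. [cite: MilneADT2006, I Theorem 1.8] -/
theorem tateDuality_classBarD_classBarInv (M : DiscreteRepCat ℤ (absoluteGaloisGroup F)) [Finite M.obj.V] :
    AdjointBijective (classBarInv F) M (show 0 + 2 = 2 from rfl) ∧
      AdjointBijective (classBarInv F) M (show 1 + 1 = 2 from rfl) ∧ ∀ x : Ext M (classBarD F) 3, x = 0 :=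
  tateDuality_finite (tateDualityHypotheses_classBarD_classBarInv F) M

/-- **`α¹(Γ_F, M)` for `classBarInv F` is injective** for every finite discrete `M` (now also as a consequence of the full
record; cf. `adjointInjective_one_classBarInv`). [cite: MilneADT2006, I Theorem 1.8 (b) and Theorem 4.10 (proof)] -/
theorem adjointMap_one_injective_classBarD_classBarInv (M : DiscreteRepCat ℤ (absoluteGaloisGroup F)) [Finite M.obj.V] :
    Function.Injective (adjointMap (classBarInv F) M (show 1 + 1 = 2 from rfl)) :=
  adjointMap_one_injective (tateDualityHypotheses_classBarD_classBarInv F) M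

end IdeleClassBar

end Literature.NumberTheory.GaloisRepresentations

end
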